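import Summits.BirchSwinnertonDyer.BirchSwinnertonDyer.Theses.GenusKolyvaginAtTwo
import Summits.BirchSwinnertonDyer.BirchSwinnertonDyer.Theorems.GenusKolyvaginAtTwoGenusDeepSupplyAtTwoNegDiscNarrowKFourCellShaCardCurrency
import Literature.NumberTheory.EllipticCurves.BSDRootNumberSmallConductorProofs
import HarnessLib

/-!
# LINE 32 «frame_rigidity⁻» — the Δ < 0 MIRROR of LINE 29 «frame_rigidity», on crux K₄⁻ `K4Neg` (stmt-BirchSwinnertonDyer-31526), route `GenusKolyvaginAtTwo`

Ideator seat `bsd-idea-1` (D-0145), generation 26; technique card «compactness–contradiction / rigidity».  A LINES workfile: the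
`theorem stub_* … := by sorry` are the REGISTERED STUBS; `K4Neg_of` is the kernel-checked composition concluding the crux BY NAME
(`Summit.BirchSwinnertonDyer.BirchSwinnertonDyer.Theses.GenusKolyvaginAtTwo.K4Neg`) modulo Q2 `KolyvaginRelationAtTwo` only — the one binder of
the LEAD's `Ш(E/ℚ)`-cardinality currency `GenusSupplyNarrow.KFourCell.ShaCardCurrency.kFourNeg_conclusion_iff_natCard_sha_rat_eq_pow` (p77xxxx, K4Neg's frame
binders VERBATIM + one odd multiplicative prime).  **No summit is proved by a line; BSD is not proved here; K4Neg is NOT proved here (three `sorry`s =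
v1.1: FIVE `sorry`s = five stubs F1⁻, F2T⁻, F2Z⁻, F2L⁻, F4⁻ — F2⁻ itself is DERIVED (`depthRigidity_of_transport`); F1⁻/F2⁻ asked only at depth `M₀ ≥ 2` of the given frame, depth one on the cut being the LEAD's theorem, item 33814).**

MIRROR NOTICE: mechanism, stubs and compositions are those of LINE 29 (`Cruxes/K4Pos/Lines/frame_rigidity.lean`, K₄⁺) with the four sign-specific
clauses of the kernel item swapped (`W.Δ < 0`; plain `#Sel₂(E) = 4` — on `Δ < 0` the real condition is automatic; twin budget `ord₂ C(Wd) ≤ 1`; the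
K₄⁻ witness clause `FrobEqFrobInfty W K 2 ℓ` for the transposition clause) and the LEAD's K₄⁻ currency theorem (exponent `2^(2·M₀)`) in place of the K₄⁺
one (`4^(M₀)`).  Filed so that the K₄⁻ kernel (no `Cruxes/K4Neg/` workfile existed) has a line of its own; not a new mechanism.

## The lever: DEPTH RIGIDITY ACROSS PRIME FRAMES (vary the frame, not the curve)

K₄⁻ at `(E, K)` is, by the LEAD's currency ↔ (mod Q2, on the cut), the FRAME-FREE statement `#Ш(E/ℚ)[2^∞] = 2^(2·M₀(E,K))`.  Hence: if SOME
admissible prime frame `K₁` of `E` attains it (F1⁻, existential) and the exact Heegner depth `M₀(E,·)` is CONSTANT over admissible prime frames of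
the cell (F2⁻, a relative statement between two rank-one twists `E^(−ℓ₀)`, `E^(−ℓ₁)`: by Gross–Zagier at both frames `L(E,1)` cancels), then K₄⁻
holds at EVERY frame (currency `.mpr`).  Off the cut (no odd multiplicative prime) the currency is unavailable: F4⁻ is the honest residual.
LOSSLESS (§2, kernel-checked mod Q2): K₄⁻ ⟹ F1⁻ and K₄⁻ ⟹ F2⁻ on the cut.

CHEAPEST FALSIFIER (F2⁻): a K₄⁻-cell curve (`Δ < 0`, `#Sel₂ = 4`, odd `C`, `ρ̄_(2^∞)` onto, an odd multiplicative prime) with two admissible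
prime frames `ℚ(√−ℓ₀)`, `ℚ(√−ℓ₁)` of DIFFERENT exact Heegner depth refutes F2⁻ (and BSD₂ for one of the two twins); instrument = the LINE 27
falsifier script (kit j340535 pattern: `ellheegner` + saturation at two frames), sign flag `Δ < 0`.

References: [Kolyvagin1989Izv] Thm. B₂ · [McCallumLMS1991] §5 Thm. 5.4, Cor. 5.6 · [GrossZagier1986] V §2 (2.2) · [GrossLMS1991] §2, §5 Prop. 5.3 ·
[Kramer1981] Thm. 1 · [KrizLi2019] Thm. 1.16 (depth transport along `E[2]`-congruences — why frame variation is the cheaper axis).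
-/

set_option autoImplicit false
set_option linter.dupNamespace false
set_option linter.unusedVariables false

noncomputable section

open scoped Classical

namespace Summit.BirchSwinnertonDyer.BirchSwinnertonDyer.Cruxes.K4Neg.FrameRigidity

open WeierstrassCurve NumberField IsDedekindDomain Field Literature.NumberTheory.EllipticCurves
  Literature.NumberTheory.GaloisRepresentations Literature.NumberTheory.EllipticCurves.ModularForms
  Literature.NumberTheory.EllipticCurves.RingClassField
open Summit.BirchSwinnertonDyer.BirchSwinnertonDyer.Theses.GenusKolyvaginAtTwo
open Summit.BirchSwinnertonDyer.BirchSwinnertonDyer.Theorems.GenusSupplyNarrow.KFourCell.ShaCardCurrency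
  (kFourNeg_conclusion_iff_natCard_sha_rat_eq_pow)

/-! ## §1 The three stubs -/

/-- **F1⁻ — FRAME ATTAINMENT (stub, rank 2 of the line).**  For `E = W` on the K₄⁻ cell WITH an odd multiplicative prime and an odd-Manin
parametrisation `Dt`, given ONE admissible prime frame `K₀` (all K₄⁻ frame binders), there is an admissible prime frame `K₁` of the same `E`
(same binders, its own datum, exact depth `M₁ ≥ 1`, its own `Sel₂`-minimal rank-one twin with `ord₂ C ≤ 1`) at which the depth ATTAINS the
`Ш`-exponent: `#Ш(E/ℚ)[2^∞] = 2^(2·M₁)`.  Equivalently SOME frame carries a K₄⁻ witness; equivalently `min_K M₀(E,K) = e(E)`.  Asked only at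
DEPTH `M₀ ≥ 2` of the given frame: depth ONE on the cut is the LEAD's THEOREM `PlusDescent.kFourNeg_conclusion_of_depth_one_of_hasMultiplicativeReductionAt`
(item 33814 `K4NegDepthOneOnCut`), consumed by name in the composition.
Why it might fail: only with BSD₂ (for `E` or for every rank-one prime twin in the cell).  Why easier than K₄⁻: existential over infinitely many
frames.  [cite: Kolyvagin1989Izv, Thm. B₂] [cite: GrossLMS1991, §2 Conj. 2.2] -/
theorem stub_frameAttainment
    (W : WeierstrassCurve ℚ) [W.IsElliptic] [W.IsGloballyMinimal] [NeZero (W.conductorNorm ℤ)]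
    (hcm : ¬ W.HasCM) (hr0 : W.analyticRank = 0) (hρ : ∀ n : ℕ, 0 < n → W.HasSurjectiveModNGaloisRep ((2 : ℤ) ^ n))
    (hT : Odd W.tamagawaProduct) (hneg : W.Δ < 0) (h4 : Nat.card (W.selmerGroup 2) = 4)
    (v : HeightOneSpectrum (𝓞 ℚ)) (h2v : ((2 : ℕ) : 𝓞 ℚ) ∉ v.asIdeal)
    (hNv : ((W.conductorNorm ℤ : ℕ) : 𝓞 ℚ) ∈ v.asIdeal) (hmult : W.HasMultiplicativeReductionAt v)
    (K₀ : Type) [Field K₀] [NumberField K₀] (hIQ₀ : IsImaginaryQuadratic K₀) (hodd₀ : Odd (NumberField.discr K₀))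
    (h3₀ : NumberField.discr K₀ ≠ -3) (hHe₀ : SatisfiesHeegnerHypothesis (W.conductorNorm ℤ) K₀)
    (hsq1₀ : ¬ IsSquare ((NumberField.discr K₀ : ℚ) * -|W.Δ|)) (hsq2₀ : ¬ IsSquare ((NumberField.discr K₀ : ℚ) * (-(2 * |W.Δ|))))
    (ℓ₀ : ℕ) (hℓ₀ : ℓ₀.Prime) (hdK₀ : NumberField.discr K₀ = -(ℓ₀ : ℤ))
    (h2K₀ : ((Ideal.span {(2 : ℤ)}).primesOver (𝓞 K₀)).ncard = 2)
    (Dt : ModularParametrizationData W (W.conductorNorm ℤ))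
    (hopt : ∀ z ∈ Dt.L.lattice, ∃ w ∈ periodLattice Dt.f, z = (Dt.c : ℂ) * w) (hc : Odd Dt.c)
    (β₀ : ℤ) (ι₀ : K₀ →+* ℂ) (d₀ : KolyvaginHeegnerData Dt β₀ ι₀ 1) (hy₀ : ¬ IsOfFinAddOrder d₀.derivedPoint)
    (M₀ : ℕ) (hdiv₀ : ∃ Q : (W.baseChange (ringClassField K₀ ι₀ 1)).toAffine.Point, ((2 ^ M₀ : ℕ) : ℤ) • Q = d₀.derivedPoint)
    (hndiv₀ : ¬ ∃ Q : (W.baseChange (ringClassField K₀ ι₀ 1)).toAffine.Point, ((2 ^ (M₀ + 1) : ℕ) : ℤ) • Q = d₀.derivedPoint)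
    (hM₀ : 1 ≤ M₀) (hM₀2 : 2 ≤ M₀)
    (Wd₀ : WeierstrassCurve ℚ) [Wd₀.IsElliptic] [Wd₀.IsGloballyMinimal]
    (hWd₀ : ∃ C : VariableChange ℚ, C • W.quadraticTwist (NumberField.discr K₀ : ℚ) = Wd₀)
    (hrd₀ : Wd₀.analyticRank = 1) (hSel₀ : Nat.card (Wd₀.selmerGroup 2) = 2) (hDEF₀ : padicValNat 2 Wd₀.tamagawaProduct ≤ 1) :
    ∃ (K₁ : Type) (_ : Field K₁) (_ : NumberField K₁),
      IsImaginaryQuadratic K₁ ∧ Odd (NumberField.discr K₁) ∧ NumberField.discr K₁ ≠ -3 ∧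
      SatisfiesHeegnerHypothesis (W.conductorNorm ℤ) K₁ ∧
      ¬ IsSquare ((NumberField.discr K₁ : ℚ) * -|W.Δ|) ∧ ¬ IsSquare ((NumberField.discr K₁ : ℚ) * (-(2 * |W.Δ|))) ∧
      ∃ (ℓ₁ : ℕ), ℓ₁.Prime ∧ NumberField.discr K₁ = -(ℓ₁ : ℤ) ∧ ((Ideal.span {(2 : ℤ)}).primesOver (𝓞 K₁)).ncard = 2 ∧
      ∃ (β₁ : ℤ) (ι₁ : K₁ →+* ℂ) (d₁ : KolyvaginHeegnerData Dt β₁ ι₁ 1), ¬ IsOfFinAddOrder d₁.derivedPoint ∧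
      ∃ (M₁ : ℕ), (∃ Q : (W.baseChange (ringClassField K₁ ι₁ 1)).toAffine.Point, ((2 ^ M₁ : ℕ) : ℤ) • Q = d₁.derivedPoint) ∧
        (¬ ∃ Q : (W.baseChange (ringClassField K₁ ι₁ 1)).toAffine.Point, ((2 ^ (M₁ + 1) : ℕ) : ℤ) • Q = d₁.derivedPoint) ∧ 1 ≤ M₁ ∧
        (∃ (Wd₁ : WeierstrassCurve ℚ) (_ : Wd₁.IsElliptic) (_ : Wd₁.IsGloballyMinimal),
          (∃ C : VariableChange ℚ, C • W.quadraticTwist (NumberField.discr K₁ : ℚ) = Wd₁) ∧ Wd₁.analyticRank = 1 ∧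
          Nat.card (Wd₁.selmerGroup 2) = 2 ∧ padicValNat 2 Wd₁.tamagawaProduct ≤ 1) ∧
        Nat.card (AddCommGroup.primaryComponent (↥W.sha) 2) = 2 ^ (2 * M₁) := by
  sorry

/-! ### F2⁻ — DEPTH RIGIDITY ACROSS PRIME FRAMES, v1.1: DERIVED from F2T⁻ (unit-layer transport, typed) + F2Z⁻ (unit-twin supply, OPEN ∃) + F2L⁻ (two-frame ledger, print-shaped)

Mirror of LINE 29 v1.2 §F2 (critic #504 P2 answered in types there; carried here).  On `Δ < 0` the twin budget is `ord₂ C(Wd) ≤ 1`, so the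
ledger keeps the Tamagawa terms and the derivation ends with a PARITY step: `2·(M₀ − M₁) = t₀ − t₁` with `t_i = ord₂ C(Wd_i) ∈ {0,1}` forces
`t₀ = t₁` and `M₀ = M₁`.  Transport sees only the unit layer (the `E[2]`-congruence between the twins is mod `2`, not mod `4`); the anchor F2Z⁻ is
Kriz–Li's horizontal SHAPE, not their (relative) theorem [KrizLi2019, Thm. 5.1] — OPEN as a ∀-cell statement. -/

/-- **F2T⁻ — TWIN-TO-TWIN UNIT-LAYER TRANSPORT (stub, rank 1).**  Two admissible prime frames of a K₄⁻ cut-cell curve (field binders; their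
`Sel₂`-minimal rank-one twins with `ord₂ C ≤ 1`; NO Heegner datum): `ord₂ Ш_an(Wd₀) = 0 ⟺ ord₂ Ш_an(Wd₁) = 0`.  Mechanism as LINE 29 F2T (common
auxiliary (★)-frame `K′`, [KrizLi2019, Thm. 1.16, Lemma 5.4, Cor. 5.5, Thm. 5.1 (2)] + Zhai's formula for the rank-`0` partners); facts (a) mod `2` not
mod `4`, (b) Kriz–Li side conditions to be met by a common `K′`.  Why it might fail: no common (★)-frame for some pair.  [cite: KrizLi2019, Thm. 1.16, Thm. 5.1] -/
theorem stub_twinTransport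
    (W : WeierstrassCurve ℚ) [W.IsElliptic] [W.IsGloballyMinimal] [NeZero (W.conductorNorm ℤ)]
    (hcm : ¬ W.HasCM) (hr0 : W.analyticRank = 0) (hρ : ∀ n : ℕ, 0 < n → W.HasSurjectiveModNGaloisRep ((2 : ℤ) ^ n))
    (hT : Odd W.tamagawaProduct) (hneg : W.Δ < 0) (h4 : Nat.card (W.selmerGroup 2) = 4)
    (v : HeightOneSpectrum (𝓞 ℚ)) (h2v : ((2 : ℕ) : 𝓞 ℚ) ∉ v.asIdeal)
    (hNv : ((W.conductorNorm ℤ : ℕ) : 𝓞 ℚ) ∈ v.asIdeal) (hmult : W.HasMultiplicativeReductionAt v)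
    (K₀ : Type) [Field K₀] [NumberField K₀] (hIQ₀ : IsImaginaryQuadratic K₀) (hodd₀ : Odd (NumberField.discr K₀))
    (h3₀ : NumberField.discr K₀ ≠ -3) (hHe₀ : SatisfiesHeegnerHypothesis (W.conductorNorm ℤ) K₀)
    (hsq1₀ : ¬ IsSquare ((NumberField.discr K₀ : ℚ) * -|W.Δ|)) (hsq2₀ : ¬ IsSquare ((NumberField.discr K₀ : ℚ) * (-(2 * |W.Δ|))))
    (ℓ₀ : ℕ) (hℓ₀ : ℓ₀.Prime) (hdK₀ : NumberField.discr K₀ = -(ℓ₀ : ℤ))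
    (h2K₀ : ((Ideal.span {(2 : ℤ)}).primesOver (𝓞 K₀)).ncard = 2)
    (Wd₀ : WeierstrassCurve ℚ) [Wd₀.IsElliptic] [Wd₀.IsGloballyMinimal]
    (hWd₀ : ∃ C : VariableChange ℚ, C • W.quadraticTwist (NumberField.discr K₀ : ℚ) = Wd₀)
    (hrd₀ : Wd₀.analyticRank = 1) (hSel₀ : Nat.card (Wd₀.selmerGroup 2) = 2) (hDEF₀ : padicValNat 2 Wd₀.tamagawaProduct ≤ 1)
    (K₁ : Type) [Field K₁] [NumberField K₁] (hIQ₁ : IsImaginaryQuadratic K₁) (hodd₁ : Odd (NumberField.discr K₁))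
    (h3₁ : NumberField.discr K₁ ≠ -3) (hHe₁ : SatisfiesHeegnerHypothesis (W.conductorNorm ℤ) K₁)
    (hsq1₁ : ¬ IsSquare ((NumberField.discr K₁ : ℚ) * -|W.Δ|)) (hsq2₁ : ¬ IsSquare ((NumberField.discr K₁ : ℚ) * (-(2 * |W.Δ|))))
    (ℓ₁ : ℕ) (hℓ₁ : ℓ₁.Prime) (hdK₁ : NumberField.discr K₁ = -(ℓ₁ : ℤ))
    (h2K₁ : ((Ideal.span {(2 : ℤ)}).primesOver (𝓞 K₁)).ncard = 2)
    (Wd₁ : WeierstrassCurve ℚ) [Wd₁.IsElliptic] [Wd₁.IsGloballyMinimal]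
    (hWd₁ : ∃ C : VariableChange ℚ, C • W.quadraticTwist (NumberField.discr K₁ : ℚ) = Wd₁)
    (hrd₁ : Wd₁.analyticRank = 1) (hSel₁ : Nat.card (Wd₁.selmerGroup 2) = 2) (hDEF₁ : padicValNat 2 Wd₁.tamagawaProduct ≤ 1) :
    (∃ q : ℚ, shaAn Wd₀ = (q : ℂ) ∧ padicValRat 2 q = 0) ↔ (∃ q : ℚ, shaAn Wd₁ = (q : ℂ) ∧ padicValRat 2 q = 0) := by
  sorry

/-- **F2Z⁻ — UNIT-TWIN SUPPLY (stub, rank 2; OPEN existential).**  Every K₄⁻ cut-cell curve has at least ONE admissible prime frame whose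
`Sel₂`-minimal rank-one twin (`ord₂ C ≤ 1`) has `ord₂ Ш_an = 0`.  `BSD₂` of that twin predicts it (`Ш(Wd)[2] = 0`); Kriz–Li give it only relative
to a numerically verified anchor pair [Thm. 5.1, Rem. 5.2]; no `p = 2` rank-one BSD formula is in print for `ρ̄₂` onto.  Why it might fail: only with
BSD₂ for every admissible twin of some cell curve.  [cite: KrizLi2019, Thm. 5.1, Rem. 5.2] [cite: GrossLMS1991, §2 Conj. 2.2] -/
theorem stub_unitTwinSupply
    (W : WeierstrassCurve ℚ) [W.IsElliptic] [W.IsGloballyMinimal] [NeZero (W.conductorNorm ℤ)]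
    (hcm : ¬ W.HasCM) (hr0 : W.analyticRank = 0) (hρ : ∀ n : ℕ, 0 < n → W.HasSurjectiveModNGaloisRep ((2 : ℤ) ^ n))
    (hT : Odd W.tamagawaProduct) (hneg : W.Δ < 0) (h4 : Nat.card (W.selmerGroup 2) = 4)
    (v : HeightOneSpectrum (𝓞 ℚ)) (h2v : ((2 : ℕ) : 𝓞 ℚ) ∉ v.asIdeal)
    (hNv : ((W.conductorNorm ℤ : ℕ) : 𝓞 ℚ) ∈ v.asIdeal) (hmult : W.HasMultiplicativeReductionAt v) :
    ∃ (K₁ : Type) (_ : Field K₁) (_ : NumberField K₁),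
      IsImaginaryQuadratic K₁ ∧ Odd (NumberField.discr K₁) ∧ NumberField.discr K₁ ≠ -3 ∧
      SatisfiesHeegnerHypothesis (W.conductorNorm ℤ) K₁ ∧
      ¬ IsSquare ((NumberField.discr K₁ : ℚ) * -|W.Δ|) ∧ ¬ IsSquare ((NumberField.discr K₁ : ℚ) * (-(2 * |W.Δ|))) ∧
      ∃ (ℓ₁ : ℕ), ℓ₁.Prime ∧ NumberField.discr K₁ = -(ℓ₁ : ℤ) ∧ ((Ideal.span {(2 : ℤ)}).primesOver (𝓞 K₁)).ncard = 2 ∧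
      ∃ (Wd₁ : WeierstrassCurve ℚ) (_ : Wd₁.IsElliptic) (_ : Wd₁.IsGloballyMinimal),
        (∃ C : VariableChange ℚ, C • W.quadraticTwist (NumberField.discr K₁ : ℚ) = Wd₁) ∧ Wd₁.analyticRank = 1 ∧
        Nat.card (Wd₁.selmerGroup 2) = 2 ∧ padicValNat 2 Wd₁.tamagawaProduct ≤ 1 ∧
        ∃ q : ℚ, shaAn Wd₁ = (q : ℂ) ∧ padicValRat 2 q = 0 := by
  sorry

/-- **F2L⁻ — THE TWO-FRAME GROSS–ZAGIER LEDGER (stub, rank 5; PRINT-shaped, modulo the route's four print items).**  Two admissible prime frames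
WITH Heegner data of a K₄⁻ cell curve and an odd-Manin `Dt`: **`2·M₀ − 2·M₁ = (ord₂ Ш_an(Wd₀) + ord₂ C(Wd₀)) − (ord₂ Ш_an(Wd₁) + ord₂ C(Wd₁))`**
(Gross–Zagier V (2.2) at both frames; every `E`-term — `L(E,1)`, `Ш_an(E)`, `C(E)`, Manin constant, the `Δ < 0` period factor — cancels).  Why it
might fail: a frame-dependent `2`-power in the period ratio or in `c_(ℓ_i)(E^(−ℓ_i))` beyond `C(Wd_i)`; template = the LEAD's K₄⁻ currency
`kFourNeg_conclusion_iff_natCard_sha_rat_eq_pow`.  [cite: GrossZagier1986, V §2 (2.2)] [cite: GrossLMS1991, §2 (2.4)] [cite: Milne1972ArithmeticAV, §1 Thm. 1] -/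
theorem stub_twoFrameLedger (hGZ : GrossZagierAllLevels) (hGZK : MultPublishedInputsAtTwo) (hL : EntireLFunctionRat) (hMi : MilneAnyModel)
    (W : WeierstrassCurve ℚ) [W.IsElliptic] [W.IsGloballyMinimal] [NeZero (W.conductorNorm ℤ)]
    (hcm : ¬ W.HasCM) (hr0 : W.analyticRank = 0) (hρ : ∀ n : ℕ, 0 < n → W.HasSurjectiveModNGaloisRep ((2 : ℤ) ^ n))
    (hT : Odd W.tamagawaProduct) (hneg : W.Δ < 0) (h4 : Nat.card (W.selmerGroup 2) = 4)
    (Dt : ModularParametrizationData W (W.conductorNorm ℤ))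
    (hopt : ∀ z ∈ Dt.L.lattice, ∃ w ∈ periodLattice Dt.f, z = (Dt.c : ℂ) * w) (hc : Odd Dt.c)
    (K₀ : Type) [Field K₀] [NumberField K₀] (hIQ₀ : IsImaginaryQuadratic K₀) (hodd₀ : Odd (NumberField.discr K₀))
    (h3₀ : NumberField.discr K₀ ≠ -3) (hHe₀ : SatisfiesHeegnerHypothesis (W.conductorNorm ℤ) K₀)
    (hsq1₀ : ¬ IsSquare ((NumberField.discr K₀ : ℚ) * -|W.Δ|)) (hsq2₀ : ¬ IsSquare ((NumberField.discr K₀ : ℚ) * (-(2 * |W.Δ|))))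
    (ℓ₀ : ℕ) (hℓ₀ : ℓ₀.Prime) (hdK₀ : NumberField.discr K₀ = -(ℓ₀ : ℤ))
    (h2K₀ : ((Ideal.span {(2 : ℤ)}).primesOver (𝓞 K₀)).ncard = 2)
    (β₀ : ℤ) (ι₀ : K₀ →+* ℂ) (d₀ : KolyvaginHeegnerData Dt β₀ ι₀ 1) (hy₀ : ¬ IsOfFinAddOrder d₀.derivedPoint)
    (M₀ : ℕ) (hdiv₀ : ∃ Q : (W.baseChange (ringClassField K₀ ι₀ 1)).toAffine.Point, ((2 ^ M₀ : ℕ) : ℤ) • Q = d₀.derivedPoint)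
    (hndiv₀ : ¬ ∃ Q : (W.baseChange (ringClassField K₀ ι₀ 1)).toAffine.Point, ((2 ^ (M₀ + 1) : ℕ) : ℤ) • Q = d₀.derivedPoint)
    (hM₀ : 1 ≤ M₀)
    (Wd₀ : WeierstrassCurve ℚ) [Wd₀.IsElliptic] [Wd₀.IsGloballyMinimal]
    (hWd₀ : ∃ C : VariableChange ℚ, C • W.quadraticTwist (NumberField.discr K₀ : ℚ) = Wd₀)
    (hrd₀ : Wd₀.analyticRank = 1) (hSel₀ : Nat.card (Wd₀.selmerGroup 2) = 2) (hDEF₀ : padicValNat 2 Wd₀.tamagawaProduct ≤ 1)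
    (K₁ : Type) [Field K₁] [NumberField K₁] (hIQ₁ : IsImaginaryQuadratic K₁) (hodd₁ : Odd (NumberField.discr K₁))
    (h3₁ : NumberField.discr K₁ ≠ -3) (hHe₁ : SatisfiesHeegnerHypothesis (W.conductorNorm ℤ) K₁)
    (hsq1₁ : ¬ IsSquare ((NumberField.discr K₁ : ℚ) * -|W.Δ|)) (hsq2₁ : ¬ IsSquare ((NumberField.discr K₁ : ℚ) * (-(2 * |W.Δ|))))
    (ℓ₁ : ℕ) (hℓ₁ : ℓ₁.Prime) (hdK₁ : NumberField.discr K₁ = -(ℓ₁ : ℤ))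
    (h2K₁ : ((Ideal.span {(2 : ℤ)}).primesOver (𝓞 K₁)).ncard = 2)
    (β₁ : ℤ) (ι₁ : K₁ →+* ℂ) (d₁ : KolyvaginHeegnerData Dt β₁ ι₁ 1) (hy₁ : ¬ IsOfFinAddOrder d₁.derivedPoint)
    (M₁ : ℕ) (hdiv₁ : ∃ Q : (W.baseChange (ringClassField K₁ ι₁ 1)).toAffine.Point, ((2 ^ M₁ : ℕ) : ℤ) • Q = d₁.derivedPoint)
    (hndiv₁ : ¬ ∃ Q : (W.baseChange (ringClassField K₁ ι₁ 1)).toAffine.Point, ((2 ^ (M₁ + 1) : ℕ) : ℤ) • Q = d₁.derivedPoint)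
    (hM₁ : 1 ≤ M₁)
    (Wd₁ : WeierstrassCurve ℚ) [Wd₁.IsElliptic] [Wd₁.IsGloballyMinimal]
    (hWd₁ : ∃ C : VariableChange ℚ, C • W.quadraticTwist (NumberField.discr K₁ : ℚ) = Wd₁)
    (hrd₁ : Wd₁.analyticRank = 1) (hSel₁ : Nat.card (Wd₁.selmerGroup 2) = 2) (hDEF₁ : padicValNat 2 Wd₁.tamagawaProduct ≤ 1)
    (q₀ q₁ : ℚ) (hq₀ : shaAn Wd₀ = (q₀ : ℂ)) (hq₁ : shaAn Wd₁ = (q₁ : ℂ)) :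
    2 * (M₀ : ℤ) - 2 * (M₁ : ℤ) =
      (padicValRat 2 q₀ + (padicValNat 2 Wd₀.tamagawaProduct : ℤ)) - (padicValRat 2 q₁ + (padicValNat 2 Wd₁.tamagawaProduct : ℤ)) := by
  sorry

/-- **F2⁻ DERIVED (no `sorry` of its own): F2T⁻ → F2Z⁻ → F2L⁻ → `M₀ = M₁`** (parity step on the Tamagawa budgets `≤ 1`), modulo the four print items. -/
theorem depthRigidity_of_transport (hGZ : GrossZagierAllLevels) (hGZK : MultPublishedInputsAtTwo) (hL : EntireLFunctionRat)
    (hMi : MilneAnyModel)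
    (W : WeierstrassCurve ℚ) [W.IsElliptic] [W.IsGloballyMinimal] [NeZero (W.conductorNorm ℤ)]
    (hcm : ¬ W.HasCM) (hr0 : W.analyticRank = 0) (hρ : ∀ n : ℕ, 0 < n → W.HasSurjectiveModNGaloisRep ((2 : ℤ) ^ n))
    (hT : Odd W.tamagawaProduct) (hneg : W.Δ < 0) (h4 : Nat.card (W.selmerGroup 2) = 4)
    (v : HeightOneSpectrum (𝓞 ℚ)) (h2v : ((2 : ℕ) : 𝓞 ℚ) ∉ v.asIdeal)
    (hNv : ((W.conductorNorm ℤ : ℕ) : 𝓞 ℚ) ∈ v.asIdeal) (hmult : W.HasMultiplicativeReductionAt v)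
    (Dt : ModularParametrizationData W (W.conductorNorm ℤ))
    (hopt : ∀ z ∈ Dt.L.lattice, ∃ w ∈ periodLattice Dt.f, z = (Dt.c : ℂ) * w) (hc : Odd Dt.c)
    (K₀ : Type) [Field K₀] [NumberField K₀] (hIQ₀ : IsImaginaryQuadratic K₀) (hodd₀ : Odd (NumberField.discr K₀))
    (h3₀ : NumberField.discr K₀ ≠ -3) (hHe₀ : SatisfiesHeegnerHypothesis (W.conductorNorm ℤ) K₀)
    (hsq1₀ : ¬ IsSquare ((NumberField.discr K₀ : ℚ) * -|W.Δ|)) (hsq2₀ : ¬ IsSquare ((NumberField.discr K₀ : ℚ) * (-(2 * |W.Δ|))))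
    (ℓ₀ : ℕ) (hℓ₀ : ℓ₀.Prime) (hdK₀ : NumberField.discr K₀ = -(ℓ₀ : ℤ))
    (h2K₀ : ((Ideal.span {(2 : ℤ)}).primesOver (𝓞 K₀)).ncard = 2)
    (β₀ : ℤ) (ι₀ : K₀ →+* ℂ) (d₀ : KolyvaginHeegnerData Dt β₀ ι₀ 1) (hy₀ : ¬ IsOfFinAddOrder d₀.derivedPoint)
    (M₀ : ℕ) (hdiv₀ : ∃ Q : (W.baseChange (ringClassField K₀ ι₀ 1)).toAffine.Point, ((2 ^ M₀ : ℕ) : ℤ) • Q = d₀.derivedPoint)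
    (hndiv₀ : ¬ ∃ Q : (W.baseChange (ringClassField K₀ ι₀ 1)).toAffine.Point, ((2 ^ (M₀ + 1) : ℕ) : ℤ) • Q = d₀.derivedPoint)
    (hM₀ : 1 ≤ M₀) (hM₀2 : 2 ≤ M₀)
    (Wd₀ : WeierstrassCurve ℚ) [Wd₀.IsElliptic] [Wd₀.IsGloballyMinimal]
    (hWd₀ : ∃ C : VariableChange ℚ, C • W.quadraticTwist (NumberField.discr K₀ : ℚ) = Wd₀)
    (hrd₀ : Wd₀.analyticRank = 1) (hSel₀ : Nat.card (Wd₀.selmerGroup 2) = 2) (hDEF₀ : padicValNat 2 Wd₀.tamagawaProduct ≤ 1)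
    (K₁ : Type) [Field K₁] [NumberField K₁] (hIQ₁ : IsImaginaryQuadratic K₁) (hodd₁ : Odd (NumberField.discr K₁))
    (h3₁ : NumberField.discr K₁ ≠ -3) (hHe₁ : SatisfiesHeegnerHypothesis (W.conductorNorm ℤ) K₁)
    (hsq1₁ : ¬ IsSquare ((NumberField.discr K₁ : ℚ) * -|W.Δ|)) (hsq2₁ : ¬ IsSquare ((NumberField.discr K₁ : ℚ) * (-(2 * |W.Δ|))))
    (ℓ₁ : ℕ) (hℓ₁ : ℓ₁.Prime) (hdK₁ : NumberField.discr K₁ = -(ℓ₁ : ℤ))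
    (h2K₁ : ((Ideal.span {(2 : ℤ)}).primesOver (𝓞 K₁)).ncard = 2)
    (β₁ : ℤ) (ι₁ : K₁ →+* ℂ) (d₁ : KolyvaginHeegnerData Dt β₁ ι₁ 1) (hy₁ : ¬ IsOfFinAddOrder d₁.derivedPoint)
    (M₁ : ℕ) (hdiv₁ : ∃ Q : (W.baseChange (ringClassField K₁ ι₁ 1)).toAffine.Point, ((2 ^ M₁ : ℕ) : ℤ) • Q = d₁.derivedPoint)
    (hndiv₁ : ¬ ∃ Q : (W.baseChange (ringClassField K₁ ι₁ 1)).toAffine.Point, ((2 ^ (M₁ + 1) : ℕ) : ℤ) • Q = d₁.derivedPoint)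
    (hM₁ : 1 ≤ M₁)
    (Wd₁ : WeierstrassCurve ℚ) [Wd₁.IsElliptic] [Wd₁.IsGloballyMinimal]
    (hWd₁ : ∃ C : VariableChange ℚ, C • W.quadraticTwist (NumberField.discr K₁ : ℚ) = Wd₁)
    (hrd₁ : Wd₁.analyticRank = 1) (hSel₁ : Nat.card (Wd₁.selmerGroup 2) = 2) (hDEF₁ : padicValNat 2 Wd₁.tamagawaProduct ≤ 1) :
    M₀ = M₁ := by
  obtain ⟨Kz, _iF, _iN, hIQz, hoddz, h3z, hHez, hsq1z, hsq2z, ℓz, hℓz, hdKz, h2Kz, Wdz, _iE, _iG, hWdz, hrdz, hSelz, hDEFz, hUz⟩ :=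
    stub_unitTwinSupply W hcm hr0 hρ hT hneg h4 v h2v hNv hmult
  obtain ⟨q₀, hq₀, hv₀⟩ := (stub_twinTransport W hcm hr0 hρ hT hneg h4 v h2v hNv hmult Kz hIQz hoddz h3z hHez hsq1z hsq2z ℓz hℓz hdKz
    h2Kz Wdz hWdz hrdz hSelz hDEFz K₀ hIQ₀ hodd₀ h3₀ hHe₀ hsq1₀ hsq2₀ ℓ₀ hℓ₀ hdK₀ h2K₀ Wd₀ hWd₀ hrd₀ hSel₀ hDEF₀).mp hUz
  obtain ⟨q₁, hq₁, hv₁⟩ := (stub_twinTransport W hcm hr0 hρ hT hneg h4 v h2v hNv hmult Kz hIQz hoddz h3z hHez hsq1z hsq2z ℓz hℓz hdKz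
    h2Kz Wdz hWdz hrdz hSelz hDEFz K₁ hIQ₁ hodd₁ h3₁ hHe₁ hsq1₁ hsq2₁ ℓ₁ hℓ₁ hdK₁ h2K₁ Wd₁ hWd₁ hrd₁ hSel₁ hDEF₁).mp hUz
  have hLdg := stub_twoFrameLedger hGZ hGZK hL hMi W hcm hr0 hρ hT hneg h4 Dt hopt hc K₀ hIQ₀ hodd₀ h3₀ hHe₀ hsq1₀ hsq2₀ ℓ₀ hℓ₀ hdK₀ h2K₀
    β₀ ι₀ d₀ hy₀ M₀ hdiv₀ hndiv₀ hM₀ Wd₀ hWd₀ hrd₀ hSel₀ hDEF₀ K₁ hIQ₁ hodd₁ h3₁ hHe₁ hsq1₁ hsq2₁ ℓ₁ hℓ₁ hdK₁ h2K₁ β₁ ι₁ d₁ hy₁ M₁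
    hdiv₁ hndiv₁ hM₁ Wd₁ hWd₁ hrd₁ hSel₁ hDEF₁ q₀ q₁ hq₀ hq₁
  rw [hv₀, hv₁] at hLdg
  have ht₀ : (padicValNat 2 Wd₀.tamagawaProduct : ℤ) ≤ 1 := by exact_mod_cast hDEF₀
  have ht₁ : (padicValNat 2 Wd₁.tamagawaProduct : ℤ) ≤ 1 := by exact_mod_cast hDEF₁
  omega

/-- **F4⁻ — THE OFF-CUT RESIDUAL (stub, rank 3).**  K₄⁻ VERBATIM on the curves of the cell with NO odd prime of multiplicative reduction, where the
LEAD's `ℚ`-currency theorems (which need a multiplicative prime `v ∤ 2` for Q2) are not available.  Honest residual of the line (cf. 31767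
`OffCutResidualAtTwoR` on the COUNT side).  Why it might fail: as K₄⁻ itself, on a thinner class. [cite: Kolyvagin1989Izv, Thm. B₂] -/
theorem stub_offCut
    (W : WeierstrassCurve ℚ) [W.IsElliptic] [W.IsGloballyMinimal] [NeZero (W.conductorNorm ℤ)]
    (hcm : ¬ W.HasCM) (hr0 : W.analyticRank = 0) (hρ : ∀ n : ℕ, 0 < n → W.HasSurjectiveModNGaloisRep ((2 : ℤ) ^ n))
    (hT : Odd W.tamagawaProduct) (hneg : W.Δ < 0) (h4 : Nat.card (W.selmerGroup 2) = 4)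
    (hoff : ¬ ∃ v : HeightOneSpectrum (𝓞 ℚ), ((2 : ℕ) : 𝓞 ℚ) ∉ v.asIdeal ∧ ((W.conductorNorm ℤ : ℕ) : 𝓞 ℚ) ∈ v.asIdeal ∧
      W.HasMultiplicativeReductionAt v)
    (K : Type) [Field K] [NumberField K] (hIQ : IsImaginaryQuadratic K) (hodd : Odd (NumberField.discr K))
    (h3 : NumberField.discr K ≠ -3) (hHe : SatisfiesHeegnerHypothesis (W.conductorNorm ℤ) K)
    (hsq1 : ¬ IsSquare ((NumberField.discr K : ℚ) * -|W.Δ|)) (hsq2 : ¬ IsSquare ((NumberField.discr K : ℚ) * (-(2 * |W.Δ|))))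
    (ℓ : ℕ) (hℓ : ℓ.Prime) (hdK : NumberField.discr K = -(ℓ : ℤ))
    (h2K : ((Ideal.span {(2 : ℤ)}).primesOver (𝓞 K)).ncard = 2)
    (Dt : ModularParametrizationData W (W.conductorNorm ℤ))
    (hopt : ∀ z ∈ Dt.L.lattice, ∃ w ∈ periodLattice Dt.f, z = (Dt.c : ℂ) * w) (hc : Odd Dt.c)
    (β : ℤ) (ι : K →+* ℂ) (d₁ : KolyvaginHeegnerData Dt β ι 1) (hy : ¬ IsOfFinAddOrder d₁.derivedPoint)
    (M₀ : ℕ) (hdiv : ∃ Q : (W.baseChange (ringClassField K ι 1)).toAffine.Point, ((2 ^ M₀ : ℕ) : ℤ) • Q = d₁.derivedPoint)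
    (hndiv : ¬ ∃ Q : (W.baseChange (ringClassField K ι 1)).toAffine.Point, ((2 ^ (M₀ + 1) : ℕ) : ℤ) • Q = d₁.derivedPoint)
    (hM₀ : 1 ≤ M₀)
    (Wd : WeierstrassCurve ℚ) [Wd.IsElliptic] [Wd.IsGloballyMinimal]
    (hWd : ∃ C : VariableChange ℚ, C • W.quadraticTwist (NumberField.discr K : ℚ) = Wd)
    (hrd : Wd.analyticRank = 1) (hSel : Nat.card (Wd.selmerGroup 2) = 2) (hDEF : padicValNat 2 Wd.tamagawaProduct ≤ 1) :
    ∃ (n : ℕ) (d : KolyvaginHeegnerData Dt β ι n), Squarefree n ∧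
      (∀ ℓ ∈ n.primeFactors, Zhang2014.IsKolyvaginPrime (W.conductorNorm ℤ) W K 2 ℓ ∧ 2 ≤ Zhang2014.kolyvaginIndex W 2 ℓ ∧
        FrobEqFrobInfty W K 2 ℓ) ∧
      ¬ ∃ Q : (W.baseChange (ringClassField K ι n)).toAffine.Point, (2 : ℤ) • Q = d.derivedPoint := by
  sorry

/-! ## §2 LOSSLESSNESS (kernel-checked, mod Q2): K₄⁻ ⟹ F1⁻ and K₄⁻ ⟹ F2⁻ on the cut -/

/-- **K₄⁻ ⟹ F1⁻** (take `K₁ := K₀`; the currency `.mp` turns the witness into the count).  Mod Q2. -/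
theorem frameAttainment_of_K4Neg (hQ2 : KolyvaginRelationAtTwo)
    (hK4 : Summit.BirchSwinnertonDyer.BirchSwinnertonDyer.Theses.GenusKolyvaginAtTwo.K4Neg)
    (W : WeierstrassCurve ℚ) [W.IsElliptic] [W.IsGloballyMinimal] [NeZero (W.conductorNorm ℤ)]
    (hcm : ¬ W.HasCM) (hr0 : W.analyticRank = 0) (hρ : ∀ n : ℕ, 0 < n → W.HasSurjectiveModNGaloisRep ((2 : ℤ) ^ n))
    (hT : Odd W.tamagawaProduct) (hneg : W.Δ < 0) (h4 : Nat.card (W.selmerGroup 2) = 4)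
    (v : HeightOneSpectrum (𝓞 ℚ)) (h2v : ((2 : ℕ) : 𝓞 ℚ) ∉ v.asIdeal)
    (hNv : ((W.conductorNorm ℤ : ℕ) : 𝓞 ℚ) ∈ v.asIdeal) (hmult : W.HasMultiplicativeReductionAt v)
    (K₀ : Type) [Field K₀] [NumberField K₀] (hIQ₀ : IsImaginaryQuadratic K₀) (hodd₀ : Odd (NumberField.discr K₀))
    (h3₀ : NumberField.discr K₀ ≠ -3) (hHe₀ : SatisfiesHeegnerHypothesis (W.conductorNorm ℤ) K₀)
    (hsq1₀ : ¬ IsSquare ((NumberField.discr K₀ : ℚ) * -|W.Δ|)) (hsq2₀ : ¬ IsSquare ((NumberField.discr K₀ : ℚ) * (-(2 * |W.Δ|))))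
    (ℓ₀ : ℕ) (hℓ₀ : ℓ₀.Prime) (hdK₀ : NumberField.discr K₀ = -(ℓ₀ : ℤ))
    (h2K₀ : ((Ideal.span {(2 : ℤ)}).primesOver (𝓞 K₀)).ncard = 2)
    (Dt : ModularParametrizationData W (W.conductorNorm ℤ))
    (hopt : ∀ z ∈ Dt.L.lattice, ∃ w ∈ periodLattice Dt.f, z = (Dt.c : ℂ) * w) (hc : Odd Dt.c)
    (β₀ : ℤ) (ι₀ : K₀ →+* ℂ) (d₀ : KolyvaginHeegnerData Dt β₀ ι₀ 1) (hy₀ : ¬ IsOfFinAddOrder d₀.derivedPoint)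
    (M₀ : ℕ) (hdiv₀ : ∃ Q : (W.baseChange (ringClassField K₀ ι₀ 1)).toAffine.Point, ((2 ^ M₀ : ℕ) : ℤ) • Q = d₀.derivedPoint)
    (hndiv₀ : ¬ ∃ Q : (W.baseChange (ringClassField K₀ ι₀ 1)).toAffine.Point, ((2 ^ (M₀ + 1) : ℕ) : ℤ) • Q = d₀.derivedPoint)
    (hM₀ : 1 ≤ M₀) (hM₀2 : 2 ≤ M₀)
    (Wd₀ : WeierstrassCurve ℚ) [Wd₀.IsElliptic] [Wd₀.IsGloballyMinimal]
    (hWd₀ : ∃ C : VariableChange ℚ, C • W.quadraticTwist (NumberField.discr K₀ : ℚ) = Wd₀)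
    (hrd₀ : Wd₀.analyticRank = 1) (hSel₀ : Nat.card (Wd₀.selmerGroup 2) = 2) (hDEF₀ : padicValNat 2 Wd₀.tamagawaProduct ≤ 1) :
    ∃ (K₁ : Type) (_ : Field K₁) (_ : NumberField K₁),
      IsImaginaryQuadratic K₁ ∧ Odd (NumberField.discr K₁) ∧ NumberField.discr K₁ ≠ -3 ∧
      SatisfiesHeegnerHypothesis (W.conductorNorm ℤ) K₁ ∧
      ¬ IsSquare ((NumberField.discr K₁ : ℚ) * -|W.Δ|) ∧ ¬ IsSquare ((NumberField.discr K₁ : ℚ) * (-(2 * |W.Δ|))) ∧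
      ∃ (ℓ₁ : ℕ), ℓ₁.Prime ∧ NumberField.discr K₁ = -(ℓ₁ : ℤ) ∧ ((Ideal.span {(2 : ℤ)}).primesOver (𝓞 K₁)).ncard = 2 ∧
      ∃ (β₁ : ℤ) (ι₁ : K₁ →+* ℂ) (d₁ : KolyvaginHeegnerData Dt β₁ ι₁ 1), ¬ IsOfFinAddOrder d₁.derivedPoint ∧
      ∃ (M₁ : ℕ), (∃ Q : (W.baseChange (ringClassField K₁ ι₁ 1)).toAffine.Point, ((2 ^ M₁ : ℕ) : ℤ) • Q = d₁.derivedPoint) ∧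
        (¬ ∃ Q : (W.baseChange (ringClassField K₁ ι₁ 1)).toAffine.Point, ((2 ^ (M₁ + 1) : ℕ) : ℤ) • Q = d₁.derivedPoint) ∧ 1 ≤ M₁ ∧
        (∃ (Wd₁ : WeierstrassCurve ℚ) (_ : Wd₁.IsElliptic) (_ : Wd₁.IsGloballyMinimal),
          (∃ C : VariableChange ℚ, C • W.quadraticTwist (NumberField.discr K₁ : ℚ) = Wd₁) ∧ Wd₁.analyticRank = 1 ∧
          Nat.card (Wd₁.selmerGroup 2) = 2 ∧ padicValNat 2 Wd₁.tamagawaProduct ≤ 1) ∧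
        Nat.card (AddCommGroup.primaryComponent (↥W.sha) 2) = 2 ^ (2 * M₁) := by
  have hw := hK4 W hcm hr0 hρ hT hneg h4 K₀ hIQ₀ hodd₀ h3₀ hHe₀ hsq1₀ hsq2₀ ℓ₀ hℓ₀ hdK₀ h2K₀ Dt hopt hc β₀ ι₀ d₀ hy₀ M₀ hdiv₀ hndiv₀
    hM₀ Wd₀ hWd₀ hrd₀ hSel₀ hDEF₀
  have hY := (kFourNeg_conclusion_iff_natCard_sha_rat_eq_pow hQ2 W hcm hr0 hρ hT hneg h4 K₀ hIQ₀ hodd₀ h3₀ hHe₀ hsq1₀ hsq2₀ ℓ₀ hℓ₀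
    hdK₀ h2K₀ Dt hopt hc β₀ ι₀ d₀ hy₀ M₀ hdiv₀ hndiv₀ hM₀ Wd₀ hWd₀ hrd₀ hSel₀ hDEF₀ v h2v hNv hmult).mp hw
  exact ⟨K₀, inferInstance, inferInstance, hIQ₀, hodd₀, h3₀, hHe₀, hsq1₀, hsq2₀, ℓ₀, hℓ₀, hdK₀, h2K₀, β₀, ι₀, d₀, hy₀, M₀, hdiv₀,
    hndiv₀, hM₀, ⟨Wd₀, inferInstance, inferInstance, hWd₀, hrd₀, hSel₀, hDEF₀⟩, hY⟩

/-- **K₄⁻ ⟹ F2⁻** (currency `.mp` at both frames: `2^(2·M₀) = #Ш(E/ℚ)[2^∞] = 2^(2·M₁)`).  Mod Q2. -/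
theorem depthRigidity_of_K4Neg (hQ2 : KolyvaginRelationAtTwo)
    (hK4 : Summit.BirchSwinnertonDyer.BirchSwinnertonDyer.Theses.GenusKolyvaginAtTwo.K4Neg)
    (W : WeierstrassCurve ℚ) [W.IsElliptic] [W.IsGloballyMinimal] [NeZero (W.conductorNorm ℤ)]
    (hcm : ¬ W.HasCM) (hr0 : W.analyticRank = 0) (hρ : ∀ n : ℕ, 0 < n → W.HasSurjectiveModNGaloisRep ((2 : ℤ) ^ n))
    (hT : Odd W.tamagawaProduct) (hneg : W.Δ < 0) (h4 : Nat.card (W.selmerGroup 2) = 4)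
    (v : HeightOneSpectrum (𝓞 ℚ)) (h2v : ((2 : ℕ) : 𝓞 ℚ) ∉ v.asIdeal)
    (hNv : ((W.conductorNorm ℤ : ℕ) : 𝓞 ℚ) ∈ v.asIdeal) (hmult : W.HasMultiplicativeReductionAt v)
    (Dt : ModularParametrizationData W (W.conductorNorm ℤ))
    (hopt : ∀ z ∈ Dt.L.lattice, ∃ w ∈ periodLattice Dt.f, z = (Dt.c : ℂ) * w) (hc : Odd Dt.c)
    (K₀ : Type) [Field K₀] [NumberField K₀] (hIQ₀ : IsImaginaryQuadratic K₀) (hodd₀ : Odd (NumberField.discr K₀))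
    (h3₀ : NumberField.discr K₀ ≠ -3) (hHe₀ : SatisfiesHeegnerHypothesis (W.conductorNorm ℤ) K₀)
    (hsq1₀ : ¬ IsSquare ((NumberField.discr K₀ : ℚ) * -|W.Δ|)) (hsq2₀ : ¬ IsSquare ((NumberField.discr K₀ : ℚ) * (-(2 * |W.Δ|))))
    (ℓ₀ : ℕ) (hℓ₀ : ℓ₀.Prime) (hdK₀ : NumberField.discr K₀ = -(ℓ₀ : ℤ))
    (h2K₀ : ((Ideal.span {(2 : ℤ)}).primesOver (𝓞 K₀)).ncard = 2)
    (β₀ : ℤ) (ι₀ : K₀ →+* ℂ) (d₀ : KolyvaginHeegnerData Dt β₀ ι₀ 1) (hy₀ : ¬ IsOfFinAddOrder d₀.derivedPoint)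
    (M₀ : ℕ) (hdiv₀ : ∃ Q : (W.baseChange (ringClassField K₀ ι₀ 1)).toAffine.Point, ((2 ^ M₀ : ℕ) : ℤ) • Q = d₀.derivedPoint)
    (hndiv₀ : ¬ ∃ Q : (W.baseChange (ringClassField K₀ ι₀ 1)).toAffine.Point, ((2 ^ (M₀ + 1) : ℕ) : ℤ) • Q = d₀.derivedPoint)
    (hM₀ : 1 ≤ M₀) (hM₀2 : 2 ≤ M₀)
    (Wd₀ : WeierstrassCurve ℚ) [Wd₀.IsElliptic] [Wd₀.IsGloballyMinimal]
    (hWd₀ : ∃ C : VariableChange ℚ, C • W.quadraticTwist (NumberField.discr K₀ : ℚ) = Wd₀)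
    (hrd₀ : Wd₀.analyticRank = 1) (hSel₀ : Nat.card (Wd₀.selmerGroup 2) = 2) (hDEF₀ : padicValNat 2 Wd₀.tamagawaProduct ≤ 1)
    (K₁ : Type) [Field K₁] [NumberField K₁] (hIQ₁ : IsImaginaryQuadratic K₁) (hodd₁ : Odd (NumberField.discr K₁))
    (h3₁ : NumberField.discr K₁ ≠ -3) (hHe₁ : SatisfiesHeegnerHypothesis (W.conductorNorm ℤ) K₁)
    (hsq1₁ : ¬ IsSquare ((NumberField.discr K₁ : ℚ) * -|W.Δ|)) (hsq2₁ : ¬ IsSquare ((NumberField.discr K₁ : ℚ) * (-(2 * |W.Δ|))))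
    (ℓ₁ : ℕ) (hℓ₁ : ℓ₁.Prime) (hdK₁ : NumberField.discr K₁ = -(ℓ₁ : ℤ))
    (h2K₁ : ((Ideal.span {(2 : ℤ)}).primesOver (𝓞 K₁)).ncard = 2)
    (β₁ : ℤ) (ι₁ : K₁ →+* ℂ) (d₁ : KolyvaginHeegnerData Dt β₁ ι₁ 1) (hy₁ : ¬ IsOfFinAddOrder d₁.derivedPoint)
    (M₁ : ℕ) (hdiv₁ : ∃ Q : (W.baseChange (ringClassField K₁ ι₁ 1)).toAffine.Point, ((2 ^ M₁ : ℕ) : ℤ) • Q = d₁.derivedPoint)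
    (hndiv₁ : ¬ ∃ Q : (W.baseChange (ringClassField K₁ ι₁ 1)).toAffine.Point, ((2 ^ (M₁ + 1) : ℕ) : ℤ) • Q = d₁.derivedPoint)
    (hM₁ : 1 ≤ M₁)
    (Wd₁ : WeierstrassCurve ℚ) [Wd₁.IsElliptic] [Wd₁.IsGloballyMinimal]
    (hWd₁ : ∃ C : VariableChange ℚ, C • W.quadraticTwist (NumberField.discr K₁ : ℚ) = Wd₁)
    (hrd₁ : Wd₁.analyticRank = 1) (hSel₁ : Nat.card (Wd₁.selmerGroup 2) = 2) (hDEF₁ : padicValNat 2 Wd₁.tamagawaProduct ≤ 1) :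
    M₀ = M₁ := by
  have hw₀ := hK4 W hcm hr0 hρ hT hneg h4 K₀ hIQ₀ hodd₀ h3₀ hHe₀ hsq1₀ hsq2₀ ℓ₀ hℓ₀ hdK₀ h2K₀ Dt hopt hc β₀ ι₀ d₀ hy₀ M₀ hdiv₀ hndiv₀
    hM₀ Wd₀ hWd₀ hrd₀ hSel₀ hDEF₀
  have hw₁ := hK4 W hcm hr0 hρ hT hneg h4 K₁ hIQ₁ hodd₁ h3₁ hHe₁ hsq1₁ hsq2₁ ℓ₁ hℓ₁ hdK₁ h2K₁ Dt hopt hc β₁ ι₁ d₁ hy₁ M₁ hdiv₁ hndiv₁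
    hM₁ Wd₁ hWd₁ hrd₁ hSel₁ hDEF₁
  have hY₀ := (kFourNeg_conclusion_iff_natCard_sha_rat_eq_pow hQ2 W hcm hr0 hρ hT hneg h4 K₀ hIQ₀ hodd₀ h3₀ hHe₀ hsq1₀ hsq2₀ ℓ₀ hℓ₀
    hdK₀ h2K₀ Dt hopt hc β₀ ι₀ d₀ hy₀ M₀ hdiv₀ hndiv₀ hM₀ Wd₀ hWd₀ hrd₀ hSel₀ hDEF₀ v h2v hNv hmult).mp hw₀
  have hY₁ := (kFourNeg_conclusion_iff_natCard_sha_rat_eq_pow hQ2 W hcm hr0 hρ hT hneg h4 K₁ hIQ₁ hodd₁ h3₁ hHe₁ hsq1₁ hsq2₁ ℓ₁ hℓ₁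
    hdK₁ h2K₁ Dt hopt hc β₁ ι₁ d₁ hy₁ M₁ hdiv₁ hndiv₁ hM₁ Wd₁ hWd₁ hrd₁ hSel₁ hDEF₁ v h2v hNv hmult).mp hw₁
  have h := Nat.pow_right_injective (le_refl 2) (hY₀.symm.trans hY₁)
  omega

/-- **COMPOSITION (kernel-checked; no `sorry` of its own): F1⁻ → F2⁻ → F4⁻ → K₄⁻, modulo Q2.**  Off the cut: F4⁻.  On the cut at depth `M₀ = 1`: the LEAD's
`kFourNeg_conclusion_of_depth_one_of_hasMultiplicativeReductionAt` BY NAME (item 33814).  On the cut at depth `M₀ ≥ 2`: F1⁻ supplies an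
admissible prime frame `K₁` with `#Ш(E/ℚ)[2^∞] = 2^(2·M₁)`; F2⁻ gives `M₀ = M₁`; the LEAD's currency `kFourNeg_conclusion_iff_natCard_sha_rat_eq_pow`
(mod Q2 only) at the ORIGINAL frame `K`, direction `.mpr`, is the K₄⁻ witness.  K4Neg is NOT proved (the stubs are open); no summit is proved by a line. -/
theorem K4Neg_of (hQ2 : KolyvaginRelationAtTwo) (hGZ : GrossZagierAllLevels) (hGZK : MultPublishedInputsAtTwo) (hL : EntireLFunctionRat)
    (hMi : MilneAnyModel) :
    Summit.BirchSwinnertonDyer.BirchSwinnertonDyer.Theses.GenusKolyvaginAtTwo.K4Neg := by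
  intro W _ _ _ hcm hr0 hρ hT hneg h4 K _ _ hIQ hodd h3 hHe hsq1 hsq2 ℓ₀ hℓ₀ hdK h2K Dt hopt hc β ι d₁ hy M₀ hdiv hndiv hM₀ Wd _ _ hWd
    hrd hSel hDEF
  by_cases hcut : ∃ v : HeightOneSpectrum (𝓞 ℚ), ((2 : ℕ) : 𝓞 ℚ) ∉ v.asIdeal ∧ ((W.conductorNorm ℤ : ℕ) : 𝓞 ℚ) ∈ v.asIdeal ∧
      W.HasMultiplicativeReductionAt v
  swap
  · exact stub_offCut W hcm hr0 hρ hT hneg h4 hcut K hIQ hodd h3 hHe hsq1 hsq2 ℓ₀ hℓ₀ hdK h2K Dt hopt hc β ι d₁ hy M₀ hdiv hndiv hM₀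
      Wd hWd hrd hSel hDEF
  obtain ⟨v, h2v, hNv, hmult⟩ := hcut
  -- depth ONE on the cut: the LEAD's theorem (item 33814 `K4NegDepthOneOnCut`), by name
  by_cases h1 : M₀ = 1
  · exact Summit.BirchSwinnertonDyer.BirchSwinnertonDyer.Theorems.GenusExact.PlusDescent.kFourNeg_conclusion_of_depth_one_of_hasMultiplicativeReductionAt
      hQ2 W hcm hr0 hρ hT hneg h4 v h2v hNv hmult K hIQ hodd h3 hHe hsq1 hsq2 ℓ₀ hℓ₀ hdK h2K Dt hopt hc β ι d₁ hy M₀ hdiv hndiv h1 Wd hWd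
      hrd hSel hDEF
  have hM₀2 : 2 ≤ M₀ := by omega
  -- F1⁻: an admissible prime frame `K₁` of `E` whose depth `M₁` attains the `Ш`-exponent
  obtain ⟨K₁, _instF, _instNF, hIQ₁, hodd₁, h3₁, hHe₁, hsq1₁, hsq2₁, ℓ₁, hℓ₁, hdK₁, h2K₁, β₁, ι₁, e₁, hy₁, M₁, hdiv₁, hndiv₁, hM₁,
      ⟨Wd₁, _instE₁, _instG₁, hWd₁, hrd₁, hSel₁, hDEF₁⟩, hY⟩ :=
    stub_frameAttainment W hcm hr0 hρ hT hneg h4 v h2v hNv hmult K hIQ hodd h3 hHe hsq1 hsq2 ℓ₀ hℓ₀ hdK h2K Dt hopt hc β ι d₁ hy M₀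
      hdiv hndiv hM₀ hM₀2 Wd hWd hrd hSel hDEF
  -- F2⁻: the depth is rigid across the two frames
  have hMM : M₀ = M₁ :=
    depthRigidity_of_transport hGZ hGZK hL hMi W hcm hr0 hρ hT hneg h4 v h2v hNv hmult Dt hopt hc K hIQ hodd h3 hHe hsq1 hsq2 ℓ₀ hℓ₀ hdK h2K β ι d₁ hy M₀
      hdiv hndiv hM₀ hM₀2 Wd hWd hrd hSel hDEF K₁ hIQ₁ hodd₁ h3₁ hHe₁ hsq1₁ hsq2₁ ℓ₁ hℓ₁ hdK₁ h2K₁ β₁ ι₁ e₁ hy₁ M₁ hdiv₁ hndiv₁ hM₁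
      Wd₁ hWd₁ hrd₁ hSel₁ hDEF₁
  -- currency at the original frame, direction (count ⟹ witness)
  exact (kFourNeg_conclusion_iff_natCard_sha_rat_eq_pow hQ2 W hcm hr0 hρ hT hneg h4 K hIQ hodd h3 hHe hsq1 hsq2 ℓ₀ hℓ₀ hdK h2K Dt
    hopt hc β ι d₁ hy M₀ hdiv hndiv hM₀ Wd hWd hrd hSel hDEF v h2v hNv hmult).mpr (by rw [hMM]; exact hY)

end Summit.BirchSwinnertonDyer.BirchSwinnertonDyer.Cruxes.K4Neg.FrameRigidity

end
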